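import Summits.CriticalPhenomena.CardyFormulaZ2.Theorems.HalfPlaneMarkDensityLaw.Negative.MarkEvents
import Literature.Probability.Percolation.Z2HalfPlaneTwoArm
import Literature.Probability.Percolation.LatticeSymmetry
import Literature.Probability.Percolation.CornerPercolation

/-!
# Stub `stub_twoArmPoint` (A) of line `Sketch` — crux `HalfPlaneMarkDensityLaw`
# (stmt-CriticalPhenomena-5661, route CardyBoundaryCoulombGas)

**The half-plane two-arm POINT bound for critical bond percolation on `ℤ²`, in primal
("left/right-isolated arm") form.**  For a boundary vertex `(k,0)` of the lattice half-plane
`ℤ × ℕ` and `R ≥ 1` let `liso k R` be the event that `(k,0)` is joined INSIDE the half-box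
`Λ⁺_R(k) = [k−R, k+R] × [0, R]` to its rim (left, right or top side) and that no vertex of
`[k−R, k−1] × {0}` is joined to `(k,0)` inside `Λ⁺_R(k)`; `riso k R` is the mirror image
(`[k+1, k+R] × {0}` excluded).  Then `P_{1/2}(liso k R) ≤ C / R` and `P_{1/2}(riso k R) ≤ C / R`.

Proof: W. Werner's counting argument (*Lectures on two-dimensional critical percolation*, PCMI
2007, Lecture 2, first exercise sheet, "Two-arm exponent in the half-plane"), in the tree's
cluster-counting set-up of `Literature/Probability/Percolation/Z2HalfPlaneTwoArm.lean`
(`isCrossingCluster_of_openArm`, `integral_numCrossingClusters_inter_le`,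
`exists_ratio_real_boxCrossingEvent_le_half`): with `M = K₀ n`, `R ≥ M + n + 1`, every boundary
point `x ∈ [-n, n)` at which `liso x R` occurs docks a crossing cluster of the restricted
configuration `ω ∩ E_ℍ` for the annulus `B(M) ∖ B(n)`, and DISTINCT such points dock DISTINCT
clusters — here without any planar duality: if `a < a'` were in the same cluster, an open path of
the half-plane inside `[-M, M] × [0, M] ⊆ Λ⁺_R(a')` would join `(a,0) ∈ [a'−R, a'−1] × {0}` to
`(a',0)`, against the isolation clause of `liso a' R`.  Hence `Σ_x P(liso x R) ≤ E[Z] ≤ 1`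
(iterated BK–Reimer through `integral_numCrossingClusters_inter_le`), all summands are equal by
translation invariance, so `2n · P(liso 0 R) ≤ 1`; the right-isolated event is the mirror image
under the reflection `v 0 ↦ −v 0` (`reflectIso 0`).
-/

noncomputable section

namespace Summit.CriticalPhenomena.CardyFormulaZ2.Cruxes.HalfPlaneMarkDensityLaw.SketchLine

open Literature.Probability.Percolation Literature.Probability.LatticeModels
open MeasureTheory Filter Set SimpleGraph
open Summit.CriticalPhenomena.CardyFormulaZ2.Theorems.HalfPlaneMarkDensityLaw.Negative
open Literature.Probability.Percolation.Z2HalfPlane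

namespace TwoArm

/-! ### The isolation events -/

/-- The half-box `Λ⁺_R(k) = [k−R, k+R] × [0, R]`. [folklore] -/
def hb (k : ℤ) (R : ℕ) : Set (Site 2) :=
  {v : Site 2 | 0 ≤ v 1 ∧ v 1 ≤ (R : ℤ) ∧ k - R ≤ v 0 ∧ v 0 ≤ k + R}

/-- The rim (left, right and top sides) of the half-box. [folklore] -/
def rim (k : ℤ) (R : ℕ) : Set (Site 2) :=
  {v : Site 2 | v 0 = k - R ∨ v 0 = k + R ∨ v 1 = (R : ℤ)}

/-- Left-isolated arm at `(k,0)` to distance `R`. [folklore] -/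
def liso (k : ℤ) (R : ℕ) : Set (BondConfig (Site 2)) :=
  openCrossing (hb k R) {bpt k} (rim k R) \ openCrossing (hb k R) (rowIcc (k - R) (k - 1)) {bpt k}

/-- Right-isolated arm at `(k,0)` to distance `R`. [folklore] -/
def riso (k : ℤ) (R : ℕ) : Set (BondConfig (Site 2)) :=
  openCrossing (hb k R) {bpt k} (rim k R) \ openCrossing (hb k R) (rowIcc (k + 1) (k + R)) {bpt k}

/-- The half-box is the tree's `Z2HalfPlane.siteBox`. [folklore] -/
theorem hb_eq (k : ℤ) (R : ℕ) : hb k R = ↑(siteBox k R) := by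
  ext v
  rw [Finset.mem_coe, mem_siteBox]
  simp only [hb, mem_setOf_eq]
  tauto

/-- A rim site is `Far` from the centre. [folklore] -/
theorem far_of_mem_rim {k : ℤ} {R : ℕ} {v : Site 2} (hv : v ∈ rim k R) : Far R k v := by
  simp only [rim, mem_setOf_eq] at hv
  unfold Far
  rcases hv with h | h | h
  · left; rw [h, show k - (R : ℤ) - k = -R by ring, abs_neg, abs_of_nonneg (by positivity)]
  · left; rw [h, show k + (R : ℤ) - k = R by ring, abs_of_nonneg (by positivity)]
  · right; rw [h]

/-- `bpt k = (k, 0)`. [folklore] -/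
theorem bpt_eq (k : ℤ) : bpt k = ![k, 0] := rfl

/-- Isolation events are measurable. [folklore] -/
theorem measurableSet_liso (k : ℤ) (R : ℕ) : MeasurableSet (liso k R) :=
  (measurableSet_openCrossing_of_countable _ _ _).diff (measurableSet_openCrossing_of_countable _ _ _)

/-! ### Docked clusters: a left-isolated arm docks a crossing cluster, distinct points dock distinct clusters -/

/-- A left-isolated arm at `(a,0)`, `|a| ≤ n ≤ M`, `R ≥ M + n + 1`, makes the cluster of `(a,0)` a
crossing cluster of the restricted configuration for `B(M) ∖ B(n)`. [folklore] -/
theorem isCrossingCluster_of_liso {ω : BondConfig (Site 2)} (hω : ω ⊆ (zdGraph 2).edgeSet)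
    {n M R : ℕ} (hM : 1 ≤ M) (hnM : n ≤ M) (hR : M + n + 1 ≤ R) {a : ℤ} (ha : |a| ≤ n)
    (h : ω ∈ liso a R) :
    IsCrossingCluster (ω ∩ hpEdges) n M ((boxOpenGraph (ω ∩ hpEdges) M).connectedComponentMk ![a, 0]) := by
  obtain ⟨⟨x, hx, v, hv, hxv⟩, -⟩ := h
  rw [mem_singleton_iff] at hx
  subst hx
  rw [hb_eq] at hxv
  exact isCrossingCluster_of_openArm hω hM hnM hR ha (far_of_mem_rim hv) hxv

/-- **The injection step (no duality needed).** If `a < a'`, `|a|, |a'| ≤ n ≤ M`, `R ≥ M + n`, and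
`liso a' R` holds, then `(a,0)` and `(a',0)` lie in different clusters of the restricted open graph of
`B(M)`: otherwise an open path of the half-plane inside `[-M,M] × [0,M] ⊆ Λ⁺_R(a')` joins
`(a,0) ∈ [a'−R, a'−1] × {0}` to `(a',0)`. [folklore] -/
theorem mk_ne_mk_of_liso {ω : BondConfig (Site 2)} (hω : ω ⊆ (zdGraph 2).edgeSet) {n M R : ℕ}
    (hnM : n ≤ M) (hR : M + n ≤ R) {a a' : ℤ} (haa' : a < a') (ha : |a| ≤ n) (ha' : |a'| ≤ n)
    (h' : ω ∈ liso a' R) :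
    (boxOpenGraph (ω ∩ hpEdges) M).connectedComponentMk ![a, 0] ≠
      (boxOpenGraph (ω ∩ hpEdges) M).connectedComponentMk ![a', 0] := by
  intro heq
  have ha1 := abs_le.1 ha
  have ha2 := abs_le.1 ha'
  have habox : (![a, 0] : Site 2) ∈ box 2 M :=
    vec2_mem_box.2 ⟨⟨by omega, by omega⟩, by omega, by omega⟩
  obtain ⟨P, hPω, hP⟩ := exists_walk_of_mk_eq hω (x := ![a, 0]) (by simp) habox heq
  have hconn : ω ∈ openConnIn (hb a' R) ![a, 0] ![a', 0] :=
    mem_openConnIn_of_walk P (fun z hz => by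
      have := hP z hz
      simp only [hb, mem_setOf_eq]
      omega) hPω
  refine h'.2 ⟨![a, 0], ?_, bpt a', mem_singleton _, hconn⟩
  simp only [rowIcc, mem_setOf_eq, Matrix.cons_val_one, Matrix.cons_val_zero]
  simp only [true_and]
  omega

open Classical in
/-- **The number of points of `[-n, n)` carrying `liso` is at most `Z(ω ∩ E_ℍ)`.** [folklore] -/
theorem card_filter_liso_le {ω : BondConfig (Site 2)} (hω : ω ⊆ (zdGraph 2).edgeSet)
    {n M R : ℕ} (hM : 1 ≤ M) (hnM : n ≤ M) (hR : M + n + 1 ≤ R) :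
    ((Finset.Ico (-(n : ℤ)) n).filter fun x => ω ∈ liso x R).card ≤
      numCrossingClusters (ω ∩ hpEdges) n M := by
  set W := (Finset.Ico (-(n : ℤ)) n).filter fun x => ω ∈ liso x R
  have hmemW : ∀ x : W, (-(n : ℤ) ≤ (x : ℤ) ∧ (x : ℤ) < n) ∧ ω ∈ liso (x : ℤ) R := fun x => by
    have h := Finset.mem_filter.1 x.2
    exact ⟨Finset.mem_Ico.1 h.1, h.2⟩
  have habs : ∀ x : W, |(x : ℤ)| ≤ n := fun x => by
    have := (hmemW x).1; rw [abs_le]; omega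
  let f : W → {C // IsCrossingCluster (ω ∩ hpEdges) n M C} := fun x =>
    ⟨(boxOpenGraph (ω ∩ hpEdges) M).connectedComponentMk ![(x : ℤ), 0],
      isCrossingCluster_of_liso hω hM hnM hR (habs x) (hmemW x).2⟩
  have hf : Function.Injective f := by
    intro x x' hxx'
    have hmk := congrArg Subtype.val hxx'
    simp only [f] at hmk
    by_contra hne
    have hne' : (x : ℤ) ≠ x' := fun h => hne (Subtype.ext h)
    rcases lt_or_gt_of_ne hne' with hlt | hlt
    · exact mk_ne_mk_of_liso hω hnM (by omega) hlt (habs x) (habs x') (hmemW x').2 hmk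
    · exact mk_ne_mk_of_liso hω hnM (by omega) hlt (habs x') (habs x) (hmemW x).2 hmk.symm
  have hcard := Nat.card_le_card_of_injective f hf
  rwa [Nat.card_eq_finsetCard] at hcard

/-! ### The window sum is at most `E[Z(ω ∩ E_ℍ)] ≤ 1` -/

/-- `μ` is the tree's `P_{1/2}`. [folklore] -/
theorem mu_eq : μ = bondPercolation (zdGraph 2) half := rfl

/-- **Sum over the points of `[-n, n)`**: at scale `n` with `P_{1/2}(boxCrossingEvent n (K₀ n)) ≤ 1/2`
and reach `R ≥ K₀ n + n + 1`, `Σ_{x ∈ [-n,n)} P(liso x R) ≤ 1`. [folklore] -/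
theorem sum_real_liso_le {K₀ n R : ℕ}
    (hA : (bondPercolation (zdGraph 2) half).real (boxCrossingEvent n (K₀ * n)) ≤ 1 / 2)
    (hn : 1 ≤ n) (hK₀ : 1 ≤ K₀) (hR : K₀ * n + n + 1 ≤ R) :
    ∑ x ∈ Finset.Ico (-(n : ℤ)) n, μ.real (liso x R) ≤ 1 := by
  rw [mu_eq]
  set P := bondPercolation (zdGraph 2) half with hP
  have hM : 1 ≤ K₀ * n := le_trans hn (Nat.le_mul_of_pos_left n hK₀)
  have hnM : n ≤ K₀ * n := Nat.le_mul_of_pos_left n hK₀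
  have hmeas : ∀ x : ℤ, MeasurableSet (liso x R) := fun x => measurableSet_liso x R
  have hpt : ∀ᵐ ω ∂P, ∑ x ∈ Finset.Ico (-(n : ℤ)) n, (liso x R).indicator (fun _ => (1 : ℝ)) ω ≤
      (numCrossingClusters (ω ∩ hpEdges) n (K₀ * n) : ℝ) := by
    filter_upwards [ae_subset_edgeSet (zdGraph 2) half] with ω hω
    classical
    have hcard := card_filter_liso_le (n := n) (R := R) hω hM hnM hR
    have hsum : ∑ x ∈ Finset.Ico (-(n : ℤ)) n, (liso x R).indicator (fun _ => (1 : ℝ)) ω =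
        (((Finset.Ico (-(n : ℤ)) n).filter fun x => ω ∈ liso x R).card : ℝ) := by
      rw [Finset.card_filter, Nat.cast_sum]
      refine Finset.sum_congr rfl fun x _ => ?_
      by_cases h : ω ∈ liso x R
      · rw [Set.indicator_of_mem h, if_pos h, Nat.cast_one]
      · rw [Set.indicator_of_notMem h, if_neg h, Nat.cast_zero]
    rw [hsum]
    exact_mod_cast hcard
  have hint : ∀ x ∈ Finset.Ico (-(n : ℤ)) n,
      Integrable (fun ω => (liso x R).indicator (fun _ => (1 : ℝ)) ω) P :=
    fun x _ => (integrable_const _).indicator (hmeas x)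
  have hZint : Integrable (fun ω => (numCrossingClusters (ω ∩ hpEdges) n (K₀ * n) : ℝ)) P := by
    refine Integrable.of_bound (C := ((box 2 n).card : ℝ)) ?_ (ae_of_all _ fun ω => ?_)
    · have hZm : Measurable fun ω : BondConfig (Site 2) => numCrossingClusters (ω ∩ hpEdges) n (K₀ * n) :=
        measurable_to_countable' fun k =>
          measurableSet_setOf_numCrossingClusters_inter hpEdges n (K₀ * n) (· = k)
      exact ((measurable_from_nat (f := (Nat.cast : ℕ → ℝ))).comp hZm).aestronglyMeasurable
    · rw [Real.norm_eq_abs, abs_of_nonneg (Nat.cast_nonneg _)]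
      exact_mod_cast numCrossingClusters_le_card (ω ∩ hpEdges) n (K₀ * n)
  calc ∑ x ∈ Finset.Ico (-(n : ℤ)) n, P.real (liso x R)
      = ∑ x ∈ Finset.Ico (-(n : ℤ)) n, ∫ ω, (liso x R).indicator (fun _ => (1 : ℝ)) ω ∂P := by
        refine Finset.sum_congr rfl fun x _ => ?_
        rw [integral_indicator_const _ (hmeas x), smul_eq_mul, mul_one]
    _ = ∫ ω, ∑ x ∈ Finset.Ico (-(n : ℤ)) n, (liso x R).indicator (fun _ => (1 : ℝ)) ω ∂P :=
        (integral_finsetSum _ hint).symm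
    _ ≤ ∫ ω, (numCrossingClusters (ω ∩ hpEdges) n (K₀ * n) : ℝ) ∂P :=
        integral_mono_ae (integrable_finsetSum _ hint) hZint hpt
    _ ≤ 1 := integral_numCrossingClusters_inter_le hpEdges hA

/-! ### Translation invariance along the boundary line -/

/-- Horizontal translation of the half-box. [folklore] -/
theorem image_shift_hb (x t : ℤ) (R : ℕ) :
    (Site.shift (hvec t)) '' hb x R = hb (x + t) R := by
  ext z
  simp only [Set.mem_image, Site.shift_apply, hb, mem_setOf_eq]
  constructor
  · rintro ⟨w, hw, rfl⟩
    simp only [Pi.add_apply, hvec_apply_zero, hvec_apply_one, add_zero]; omega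
  · intro hz
    refine ⟨z - hvec t, ?_, by simp⟩
    simp only [Pi.sub_apply, hvec_apply_zero, hvec_apply_one, sub_zero]; omega

/-- Horizontal translation of the rim. [folklore] -/
theorem image_shift_rim (x t : ℤ) (R : ℕ) :
    (Site.shift (hvec t)) '' rim x R = rim (x + t) R := by
  ext z
  simp only [Set.mem_image, Site.shift_apply, rim, mem_setOf_eq]
  constructor
  · rintro ⟨w, hw, rfl⟩
    simp only [Pi.add_apply, hvec_apply_zero, hvec_apply_one, add_zero]; omega
  · intro hz
    refine ⟨z - hvec t, ?_, by simp⟩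
    simp only [Pi.sub_apply, hvec_apply_zero, hvec_apply_one, sub_zero]; omega

/-- Horizontal translation of the centre. [folklore] -/
theorem image_shift_singleton_bpt (x t : ℤ) :
    (Site.shift (hvec t)) '' {bpt x} = {bpt (x + t)} := by
  rw [image_singleton, Site.shift_apply, bpt_eq, bpt_eq, vec2_add_hvec]

/-- Horizontal translation of the excluded boundary segment. [folklore] -/
theorem image_shift_rowIcc_sub (x t : ℤ) (R : ℕ) :
    (Site.shift (hvec t)) '' rowIcc (x - R) (x - 1) = rowIcc (x + t - R) (x + t - 1) := by
  ext z
  simp only [Set.mem_image, Site.shift_apply, rowIcc, mem_setOf_eq]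
  constructor
  · rintro ⟨w, hw, rfl⟩
    simp only [Pi.add_apply, hvec_apply_zero, hvec_apply_one, add_zero]; omega
  · intro hz
    refine ⟨z - hvec t, ?_, by simp⟩
    simp only [Pi.sub_apply, hvec_apply_zero, hvec_apply_one, sub_zero]; omega

/-- `liso` is carried along horizontal translations. [folklore] -/
theorem preimage_relabel_shift_liso (x t : ℤ) (R : ℕ) :
    BondConfig.relabel (sym2Equiv (Site.shift (hvec t))) ⁻¹' liso (x + t) R = liso x R := by
  rw [liso, liso, preimage_sdiff, ← image_shift_hb x t R, ← image_shift_rim x t R,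
    ← image_shift_singleton_bpt x t, ← image_shift_rowIcc_sub x t R,
    preimage_relabel_openCrossing, preimage_relabel_openCrossing]

/-- All `liso x R` have the same probability. [folklore] -/
theorem real_liso_eq (x x' : ℤ) (R : ℕ) : μ.real (liso x R) = μ.real (liso x' R) := by
  rw [← preimage_relabel_shift_liso x (x' - x) R, mu_eq, bondPercolation_real_preimage_shift,
    show x + (x' - x) = x' by ring]

/-! ### The mirror image: right-isolated arms -/

/-- The reflection `(v₀, v₁) ↦ (−v₀, v₁)` of `ℤ²`. [folklore] -/
abbrev refl : zdGraph 2 ≃g zdGraph 2 := reflectIso 0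

/-- First coordinate of the reflection. [folklore] -/
theorem refl_apply_zero (v : Site 2) : refl.toEquiv v 0 = -v 0 :=
  reflectIso_apply_same 0 v

/-- Second coordinate of the reflection. [folklore] -/
theorem refl_apply_one (v : Site 2) : refl.toEquiv v 1 = v 1 :=
  reflectIso_apply_of_ne (by decide) v

/-- The reflection is an involution. [folklore] -/
theorem refl_refl (v : Site 2) : refl.toEquiv (refl.toEquiv v) = v := by
  ext i
  fin_cases i
  · simp only [Fin.zero_eta, refl_apply_zero, neg_neg]
  · simp only [Fin.mk_one, refl_apply_one]

/-- Images under the reflection, from a pointwise description. [folklore] -/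
theorem image_refl_eq_of {S T : Set (Site 2)} (h : ∀ v, v ∈ T ↔ refl.toEquiv v ∈ S) :
    refl.toEquiv '' S = T := by
  ext v
  constructor
  · rintro ⟨w, hw, rfl⟩
    rw [h, refl_refl]; exact hw
  · intro hv
    exact ⟨refl.toEquiv v, (h v).1 hv, refl_refl v⟩

/-- Reflected half-box. [folklore] -/
theorem image_refl_hb (k : ℤ) (R : ℕ) : refl.toEquiv '' hb k R = hb (-k) R :=
  image_refl_eq_of fun v => by simp only [hb, mem_setOf_eq, refl_apply_zero, refl_apply_one]; omega

/-- Reflected rim. [folklore] -/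
theorem image_refl_rim (k : ℤ) (R : ℕ) : refl.toEquiv '' rim k R = rim (-k) R :=
  image_refl_eq_of fun v => by simp only [rim, mem_setOf_eq, refl_apply_zero, refl_apply_one]; omega

/-- Reflected centre. [folklore] -/
theorem image_refl_bpt (k : ℤ) : refl.toEquiv '' {bpt k} = {bpt (-k)} :=
  image_refl_eq_of fun v => by
    simp only [mem_singleton_iff, site_eq_bpt_iff, refl_apply_zero, refl_apply_one]; omega

/-- Reflected excluded segment. [folklore] -/
theorem image_refl_rowIcc (k : ℤ) (R : ℕ) :
    refl.toEquiv '' rowIcc (k + 1) (k + R) = rowIcc (-k - R) (-k - 1) :=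
  image_refl_eq_of fun v => by simp only [rowIcc, mem_setOf_eq, refl_apply_zero, refl_apply_one]; omega

/-- `riso k R` is the mirror image of `liso (−k) R`. [folklore] -/
theorem preimage_relabel_refl_liso (k : ℤ) (R : ℕ) :
    BondConfig.relabel (sym2Equiv refl.toEquiv) ⁻¹' liso (-k) R = riso k R := by
  rw [liso, riso, preimage_sdiff, ← image_refl_hb k R, ← image_refl_rim k R, ← image_refl_bpt k,
    ← image_refl_rowIcc k R, preimage_relabel_openCrossing, preimage_relabel_openCrossing]

/-- The right-isolated event has the probability of a left-isolated one. [folklore] -/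
theorem real_riso_eq (k : ℤ) (R : ℕ) : μ.real (riso k R) = μ.real (liso (-k) R) := by
  rw [← preimage_relabel_refl_liso, mu_eq, bondPercolation_real_preimage_relabel_iso]

/-! ### The point bound -/

/-- **`P_{1/2}(liso 0 R) ≤ C / R`** for all `R ≥ 1`. [folklore] -/
theorem real_liso_zero_le : ∃ C : ℝ, ∀ R : ℕ, 1 ≤ R → μ.real (liso 0 R) ≤ C / R := by
  obtain ⟨K₀, N₀, hK₀, hN₀, hA⟩ := exists_ratio_real_boxCrossingEvent_le_half
  refine ⟨2 * ((K₀ : ℝ) + 2) * ((N₀ : ℝ) + 1), fun R hR => ?_⟩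
  have hR0 : (0 : ℝ) < R := by exact_mod_cast hR
  set n : ℕ := R / (K₀ + 2) with hn
  have hnR : n * (K₀ + 2) ≤ R := Nat.div_mul_le_self R (K₀ + 2)
  have hRlt : R < (n + 1) * (K₀ + 2) := Nat.lt_mul_of_div_lt (Nat.lt_succ_self _) (by omega)
  have hRlt' : (R : ℝ) < ((n : ℝ) + 1) * ((K₀ : ℝ) + 2) := by exact_mod_cast hRlt
  rcases lt_or_ge n N₀ with hsmall | hbig
  · -- small `R`: the bound is trivial
    have hn1 : (n : ℝ) + 1 ≤ N₀ := by exact_mod_cast hsmall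
    calc μ.real (liso 0 R) ≤ 1 := measureReal_le_one
      _ ≤ 2 * ((K₀ : ℝ) + 2) * ((N₀ : ℝ) + 1) / R := by
          rw [le_div_iff₀ hR0, one_mul]
          nlinarith
  · have hn1 : 1 ≤ n := le_trans hN₀ hbig
    have hreach : K₀ * n + n + 1 ≤ R := by nlinarith
    have hsum := sum_real_liso_le (R := R) (hA n hbig) hn1 (by omega) hreach
    rw [Finset.sum_congr rfl fun x _ => real_liso_eq x 0 R, Finset.sum_const, Int.card_Ico,
      nsmul_eq_mul, show ((n : ℤ) - -(n : ℤ)).toNat = 2 * n by omega] at hsum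
    push_cast at hsum
    have hn0 : (0 : ℝ) < n := by exact_mod_cast hn1
    have h1 : μ.real (liso 0 R) ≤ 1 / (2 * n) := by
      rw [le_div_iff₀ (by positivity)]; linarith
    refine h1.trans ?_
    rw [div_le_div_iff₀ (by positivity) hR0, one_mul]
    have hn1' : (1 : ℝ) ≤ n := by exact_mod_cast hn1
    have h2 : ((n : ℝ) + 1) * ((K₀ : ℝ) + 2) ≤ 2 * n * ((K₀ : ℝ) + 2) :=
      mul_le_mul_of_nonneg_right (by linarith) (by positivity)
    have h3 : 2 * (n : ℝ) * ((K₀ : ℝ) + 2) ≤ 2 * ((K₀ : ℝ) + 2) * ((N₀ : ℝ) + 1) * (2 * n) := by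
      rw [show 2 * ((K₀ : ℝ) + 2) * ((N₀ : ℝ) + 1) * (2 * n) = 2 * (n : ℝ) * ((K₀ : ℝ) + 2) * (2 * ((N₀ : ℝ) + 1))
        by ring]
      exact le_mul_of_one_le_right (by positivity) (by linarith)
    linarith

end TwoArm

open TwoArm in
/-- **STUB A of line `Sketch` (registered signature): the half-plane two-arm point bound for
critical bond percolation on `ℤ²`, both orientations.** [folklore] -/
theorem stub_twoArmPoint :
    ∃ C : ℝ, ∀ (k : ℤ) (R : ℕ), 1 ≤ R →
      μ.real (openCrossing {v : Site 2 | 0 ≤ v 1 ∧ v 1 ≤ (R : ℤ) ∧ k - R ≤ v 0 ∧ v 0 ≤ k + R} {bpt k}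
            {v : Site 2 | v 0 = k - R ∨ v 0 = k + R ∨ v 1 = (R : ℤ)} \
          openCrossing {v : Site 2 | 0 ≤ v 1 ∧ v 1 ≤ (R : ℤ) ∧ k - R ≤ v 0 ∧ v 0 ≤ k + R}
            (rowIcc (k - R) (k - 1)) {bpt k}) ≤ C / R ∧
      μ.real (openCrossing {v : Site 2 | 0 ≤ v 1 ∧ v 1 ≤ (R : ℤ) ∧ k - R ≤ v 0 ∧ v 0 ≤ k + R} {bpt k}
            {v : Site 2 | v 0 = k - R ∨ v 0 = k + R ∨ v 1 = (R : ℤ)} \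
          openCrossing {v : Site 2 | 0 ≤ v 1 ∧ v 1 ≤ (R : ℤ) ∧ k - R ≤ v 0 ∧ v 0 ≤ k + R}
            (rowIcc (k + 1) (k + R)) {bpt k}) ≤ C / R := by
  show ∃ C : ℝ, ∀ (k : ℤ) (R : ℕ), 1 ≤ R → μ.real (liso k R) ≤ C / R ∧ μ.real (riso k R) ≤ C / R
  obtain ⟨C, hC⟩ := real_liso_zero_le
  refine ⟨C, fun k R hR => ⟨?_, ?_⟩⟩
  · rw [real_liso_eq k 0 R]; exact hC R hR
  · rw [real_riso_eq, real_liso_eq (-k) 0 R]; exact hC R hR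

end Summit.CriticalPhenomena.CardyFormulaZ2.Cruxes.HalfPlaneMarkDensityLaw.SketchLine
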